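import Mathlib.Geometry.Manifold.ContMDiffMFDeriv
import Mathlib.Analysis.Calculus.BumpFunction.FiniteDimension
import Mathlib.Analysis.Calculus.ContDiff.FiniteDimension
import Mathlib.Analysis.Normed.Module.Alternating.Basic
import Literature.Geometry.Kaehler.ManifoldFormsEval
import Literature.Geometry.Kaehler.ManifoldFormsPullback
import Literature.Geometry.Manifold.FreeCircleAction
import Literature.Geometry.Manifold.CircleActionOrbitAverage
import Literature.Analysis.FunctionSpaces.SmoothParametricIntegral
import HarnessLib

/-!
# Averaging a smooth `1`-form over a smooth circle action

General differential topology (topic `Geometry/Manifold`), written for step (S1) of the fact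
`Literature.Geometry.Symplectic.exists_symplecticCutPieces_of_isOrigamiForm` (Cannas da Silva–
Guillemin–Pires 2010, Prop. 2.8; Cannas da Silva–Guillemin–Woodward 2000, Thm. 1): the
**connection form** of the null fibration is the average `ᾱ = (2π)⁻¹ ∫₀^{2π} (e^{is})^* α ds`
of any smooth `1`-form `α` with `α(X) = 1`.  For a smooth action of Mathlib's `Circle` on a
manifold `N` modelled on `ℝᵐ` (`[MulAction Circle N]` with `C^∞` action map, the convention of
`Literature/Geometry/Manifold/FreeCircleQuotient.lean`) and a smooth `1`-form `α`
(`Literature.Geometry.Kaehler.MForm`, `IsSmoothForm`):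

* `contMDiffAt_apply_smul_section` — the integrand `(s, y) ↦ α_{e^{is} y}(d(e^{is}·)_y V_y)` is
  `C^∞` on `ℝ × N` for a smooth vector field `V` (the pull-back of `α` along the action map
  `ℝ × N → N` evaluated on the smooth field `(0, V)`, `IsSmoothForm.contMDiffAt_apply_sections`);
* `exists_circleAverage_oneForm` — **there is a smooth `1`-form `ᾱ` with
  `ᾱ_y(v) = (2π)⁻¹ ∫₀^{2π} α_{e^{is} y}(d(e^{is}·)_y v) ds`, invariant under the action**
  (smoothness: parametric integrals in charts, `contDiff_parametric_intervalIntegral`;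
  invariance: the group law and `2π`-periodicity).

Everything is proved; no definitions (the average is characterised by its values), no facts.

## References

* D. McDuff, D. Salamon, *Introduction to Symplectic Topology*, 3rd ed. (2017), §5.5
  (averaging over a compact group action). [McDuffSalamon2017]
* A. Cannas da Silva, V. Guillemin, C. Woodward, *On the unfolding of folded symplectic
  structures*, Math. Res. Lett. 7 (2000), proof of Thm. 1. [CannasGuilleminWoodward2000]
-/

noncomputable section

open scoped Manifold ContDiff Topology Real
open Set Function Filter Bundle
open Literature.Geometry.Kaehler

namespace Literature.Geometry.Manifold

variable {m : ℕ} {N : Type*} [TopologicalSpace N] [ChartedSpace (EuclideanSpace ℝ (Fin m)) N]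
  [IsManifold (𝓡 m) ∞ N] [MulAction Circle N]

/-! ### The action map on `ℝ × N` and the integrand -/

omit [IsManifold (𝓡 m) ∞ N] in
/-- The action map `(s, y) ↦ e^{is} • y` is `C^∞` on `ℝ × N`. [folklore] -/
theorem contMDiff_expSmul
    (hθ : ContMDiff ((𝓡 1).prod (𝓡 m)) (𝓡 m) ∞ (fun x : Circle × N => x.1 • x.2)) :
    ContMDiff (𝓘(ℝ, ℝ).prod (𝓡 m)) (𝓡 m) ∞ (fun p : ℝ × N => Circle.exp p.1 • p.2) :=
  hθ.comp (((contMDiff_circleExp (m := ∞)).comp contMDiff_fst).prodMk contMDiff_snd)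

omit [IsManifold (𝓡 m) ∞ N] in
/-- `d(e^{is}·)_y v = dΦ_{(s,y)}(0, v)` for the action map `Φ(s, y) = e^{is} • y`. [folklore] -/
theorem mfderiv_smul_eq_mfderiv_expSmul
    (hθ : ContMDiff ((𝓡 1).prod (𝓡 m)) (𝓡 m) ∞ (fun x : Circle × N => x.1 • x.2))
    (s : ℝ) (y : N) (v : TangentSpace (𝓡 m) y) :
    mfderiv (𝓡 m) (𝓡 m) (fun x : N => Circle.exp s • x) y v =
      mfderiv (𝓘(ℝ, ℝ).prod (𝓡 m)) (𝓡 m) (fun p : ℝ × N => Circle.exp p.1 • p.2) (s, y)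
        (((0 : ℝ), (v : EuclideanSpace ℝ (Fin m))) : ℝ × EuclideanSpace ℝ (Fin m)) := by
  set Φ : ℝ × N → N := fun p => Circle.exp p.1 • p.2 with hΦ
  have hι : HasMFDerivAt (𝓡 m) (𝓘(ℝ, ℝ).prod (𝓡 m)) (fun x : N => ((s, x) : ℝ × N)) y
      ((0 : EuclideanSpace ℝ (Fin m) →L[ℝ] ℝ).prod
        (ContinuousLinearMap.id ℝ (EuclideanSpace ℝ (Fin m)))) :=
    (hasMFDerivAt_const s y).prodMk (hasMFDerivAt_id y)
  have hd : MDifferentiableAt (𝓘(ℝ, ℝ).prod (𝓡 m)) (𝓡 m) Φ (s, y) :=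
    (contMDiff_expSmul hθ).mdifferentiableAt (by norm_num)
  have hcomp := hd.hasMFDerivAt.comp y hι
  have heq : Φ ∘ (fun x : N => ((s, x) : ℝ × N)) = fun x : N => Circle.exp s • x := rfl
  rw [heq] at hcomp
  exact congrArg (fun L => L v) hcomp.mfderiv

omit [MulAction Circle N] in
/-- The vector field `(s, y) ↦ (0, V y)` on `ℝ × N` is smooth at `(s, y)` when `V` is smooth at
`y` (Mathlib's `contMDiff_equivTangentBundleProd_symm`). [folklore] -/
theorem contMDiffAt_inrSection {V : Π y : N, TangentSpace (𝓡 m) y} {y : N}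
    (hV : ContMDiffAt (𝓡 m) (𝓡 m).tangent ∞ (fun z => (⟨z, V z⟩ : TangentBundle (𝓡 m) N)) y)
    (s : ℝ) :
    ContMDiffAt (𝓘(ℝ, ℝ).prod (𝓡 m)) (𝓘(ℝ, ℝ).prod (𝓡 m)).tangent ∞
      (fun p : ℝ × N => (⟨p, (((0 : ℝ), (V p.2 : EuclideanSpace ℝ (Fin m))) :
        ℝ × EuclideanSpace ℝ (Fin m))⟩ : TangentBundle (𝓘(ℝ, ℝ).prod (𝓡 m)) (ℝ × N))) (s, y) := by
  have hzero : ContMDiff 𝓘(ℝ, ℝ) 𝓘(ℝ, ℝ).tangent ∞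
      (fun t : ℝ => (⟨t, 0⟩ : TangentBundle 𝓘(ℝ, ℝ) ℝ)) :=
    contMDiff_zeroSection ℝ (TangentSpace 𝓘(ℝ, ℝ) : ℝ → Type _)
  have hpair : ContMDiffAt (𝓘(ℝ, ℝ).prod (𝓡 m)) (𝓘(ℝ, ℝ).tangent.prod (𝓡 m).tangent) ∞
      (fun p : ℝ × N =>
        ((⟨p.1, 0⟩ : TangentBundle 𝓘(ℝ, ℝ) ℝ), (⟨p.2, V p.2⟩ : TangentBundle (𝓡 m) N)))
      (s, y) :=
    (hzero.contMDiffAt.comp (s, y) contMDiffAt_fst).prodMk (hV.comp (s, y) contMDiffAt_snd)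
  have h := (contMDiff_equivTangentBundleProd_symm (I := 𝓘(ℝ, ℝ)) (M := ℝ) (I' := 𝓡 m)
    (M' := N) (n := ∞)).contMDiffAt.comp (s, y) hpair
  exact h.congr_of_eventuallyEq (Eventually.of_forall fun p => rfl)

/-- The pull-back of a smooth form along the action map is smooth. [folklore] -/
theorem isSmoothForm_pullback_expSmul {k : ℕ}
    (hθ : ContMDiff ((𝓡 1).prod (𝓡 m)) (𝓡 m) ∞ (fun x : Circle × N => x.1 • x.2))
    {α : MForm (𝓡 m) N ℝ k} (hα : IsSmoothForm α) :
    IsSmoothForm (α.pullback (𝓘(ℝ, ℝ).prod (𝓡 m)) (fun p : ℝ × N => Circle.exp p.1 • p.2)) := by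
  rw [isSmoothForm_iff_smoothAt] at hα ⊢
  intro p
  exact MForm.SmoothAt.pullback (Eventually.of_forall fun q => (contMDiff_expSmul hθ q)) (hα _)

/-- **The averaging integrand is jointly smooth**: for a smooth `1`-form `α`, a smooth action
and a vector field `V` smooth at `y`, the function `(s, z) ↦ α_{e^{is} z}(d(e^{is}·)_z V_z)` is
`C^∞` at `(s, y)`. [folklore] -/
theorem contMDiffAt_apply_smul_section
    (hθ : ContMDiff ((𝓡 1).prod (𝓡 m)) (𝓡 m) ∞ (fun x : Circle × N => x.1 • x.2))
    {α : MForm (𝓡 m) N ℝ 1} (hα : IsSmoothForm α) {V : Π y : N, TangentSpace (𝓡 m) y} {y : N}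
    (hV : ContMDiffAt (𝓡 m) (𝓡 m).tangent ∞ (fun z => (⟨z, V z⟩ : TangentBundle (𝓡 m) N)) y)
    (s : ℝ) :
    ContMDiffAt (𝓘(ℝ, ℝ).prod (𝓡 m)) 𝓘(ℝ, ℝ) ∞ (fun p : ℝ × N => α (Circle.exp p.1 • p.2)
      ![mfderiv (𝓡 m) (𝓡 m) (fun x : N => Circle.exp p.1 • x) p.2 (V p.2)]) (s, y) := by
  have h := (isSmoothForm_pullback_expSmul hθ hα).contMDiffAt_apply_sections
    (V := fun _ : Fin 1 => fun p : ℝ × N =>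
      (((0 : ℝ), (V p.2 : EuclideanSpace ℝ (Fin m))) : ℝ × EuclideanSpace ℝ (Fin m)))
    (x₀ := (s, y)) (fun _ => contMDiffAt_inrSection hV s)
  refine h.congr_of_eventuallyEq (Eventually.of_forall fun p => ?_)
  show α (Circle.exp p.1 • p.2)
      ![mfderiv (𝓡 m) (𝓡 m) (fun x : N => Circle.exp p.1 • x) p.2 (V p.2)] =
    (α.pullback (𝓘(ℝ, ℝ).prod (𝓡 m)) (fun p : ℝ × N => Circle.exp p.1 • p.2)) p
      (fun _ : Fin 1 =>
        (((0 : ℝ), (V p.2 : EuclideanSpace ℝ (Fin m))) : ℝ × EuclideanSpace ℝ (Fin m)))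
  rw [MForm.pullback_apply]
  congr 1
  funext i
  fin_cases i
  exact mfderiv_smul_eq_mfderiv_expSmul hθ p.1 p.2 (V p.2)

/-! ### Coordinate vector fields -/

omit [MulAction Circle N] in
/-- **Coordinate vector fields are smooth**: the field `z ↦ τ_{x₀ → z} e` transporting a fixed
model vector `e` from the chart at `x₀` (`tangentCoordChange`) is smooth on the chart source (in
the trivialisation at `x₀` it is the constant `e`). [folklore] -/
theorem contMDiffAt_coordField (x₀ : N) (e : EuclideanSpace ℝ (Fin m)) {y : N}
    (hy : y ∈ (chartAt (EuclideanSpace ℝ (Fin m)) x₀).source) :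
    ContMDiffAt (𝓡 m) (𝓡 m).tangent ∞ (fun z => (⟨z, tangentCoordChange (𝓡 m) x₀ z z e⟩ :
      TangentBundle (𝓡 m) N)) y := by
  rw [(trivializationAt (EuclideanSpace ℝ (Fin m)) (TangentSpace (𝓡 m)) x₀).contMDiffAt_section_iff
    (by simpa only [TangentBundle.trivializationAt_baseSet] using hy)]
  refine (contMDiffAt_const (c := e)).congr_of_eventuallyEq ?_
  filter_upwards [(chartAt (EuclideanSpace ℝ (Fin m)) x₀).open_source.mem_nhds hy] with z hz
  have hz' : z ∈ (extChartAt (𝓡 m) x₀).source := by rwa [extChartAt_source]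
  have hmem : z ∈ (extChartAt (𝓡 m) x₀).source ∩ (extChartAt (𝓡 m) z).source ∩
      (extChartAt (𝓡 m) x₀).source := ⟨⟨hz', mem_extChartAt_source z⟩, hz'⟩
  show tangentCoordChange (𝓡 m) z x₀ z (tangentCoordChange (𝓡 m) x₀ z z e) = e
  rw [tangentCoordChange_comp hmem]
  exact tangentCoordChange_self hz'

omit [MulAction Circle N] in
/-- At the point itself the coordinate field of `e` read back in the chart at `y` is `e`:
`τ_{y → y} e = e`. [folklore] -/
theorem coordField_self (y : N) (e : EuclideanSpace ℝ (Fin m)) :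
    tangentCoordChange (𝓡 m) y y y e = e :=
  tangentCoordChange_self (mem_extChartAt_source y)

/-- **Continuity of the integrand in `s`** at a fixed point and vector. [folklore] -/
theorem continuous_apply_smul
    (hθ : ContMDiff ((𝓡 1).prod (𝓡 m)) (𝓡 m) ∞ (fun x : Circle × N => x.1 • x.2))
    {α : MForm (𝓡 m) N ℝ 1} (hα : IsSmoothForm α) (y : N) (v : TangentSpace (𝓡 m) y) :
    Continuous (fun s : ℝ => α (Circle.exp s • y)
      ![mfderiv (𝓡 m) (𝓡 m) (fun x : N => Circle.exp s • x) y v]) := by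
  have hV := contMDiffAt_coordField (m := m) y (v : EuclideanSpace ℝ (Fin m))
    (mem_chart_source _ y)
  rw [continuous_iff_continuousAt]
  intro s
  have h := (contMDiffAt_apply_smul_section hθ hα hV s).continuousAt
  have h2 : ContinuousAt (fun s : ℝ => ((s, y) : ℝ × N)) s :=
    (continuous_id.prodMk continuous_const).continuousAt
  have h3 := ContinuousAt.comp (f := fun s : ℝ => ((s, y) : ℝ × N)) (x := s) h h2
  refine h3.congr (Eventually.of_forall fun t => ?_)
  simp only [Function.comp_apply, coordField_self]


/-! ### The averaged `1`-form: construction -/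

/-- **The circle average of a `1`-form exists as a `1`-form**: there is a `1`-form `ᾱ` with
`ᾱ_y(v) = (2π)⁻¹ ∫₀^{2π} α_{e^{is} y}(d(e^{is}·)_y v) ds` (the integrand is continuous in `s`,
so the integral is linear in `v`). [folklore] -/
theorem exists_oneForm_circleAverage
    (hθ : ContMDiff ((𝓡 1).prod (𝓡 m)) (𝓡 m) ∞ (fun x : Circle × N => x.1 • x.2))
    {α : MForm (𝓡 m) N ℝ 1} (hα : IsSmoothForm α) :
    ∃ ᾱ : MForm (𝓡 m) N ℝ 1, ∀ (y : N) (v : TangentSpace (𝓡 m) y), ᾱ y ![v] =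
      (2 * π)⁻¹ * ∫ s in (0 : ℝ)..2 * π, α (Circle.exp s • y)
        ![mfderiv (𝓡 m) (𝓡 m) (fun x : N => Circle.exp s • x) y v] := by
  have hint : ∀ (y : N) (v : EuclideanSpace ℝ (Fin m)), IntervalIntegrable
      (fun s : ℝ => α (Circle.exp s • y)
        ![mfderiv (𝓡 m) (𝓡 m) (fun x : N => Circle.exp s • x) y v])
      MeasureTheory.volume 0 (2 * π) :=
    fun y v => (continuous_apply_smul hθ hα y v).intervalIntegrable _ _
  have hlin : ∀ y : N, IsLinearMap ℝ (fun v : EuclideanSpace ℝ (Fin m) =>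
      (2 * π)⁻¹ * ∫ s in (0 : ℝ)..2 * π, α (Circle.exp s • y)
        ![mfderiv (𝓡 m) (𝓡 m) (fun x : N => Circle.exp s • x) y v]) := by
    intro y
    constructor
    · intro v w
      have hfun : (fun s : ℝ => α (Circle.exp s • y)
          ![mfderiv (𝓡 m) (𝓡 m) (fun x : N => Circle.exp s • x) y (v + w)]) =
          fun s : ℝ => α (Circle.exp s • y)
            ![mfderiv (𝓡 m) (𝓡 m) (fun x : N => Circle.exp s • x) y v] +
          α (Circle.exp s • y) ![mfderiv (𝓡 m) (𝓡 m) (fun x : N => Circle.exp s • x) y w] := by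
        funext s
        exact (congrArg (fun z => α (Circle.exp s • y) ![z])
          ((mfderiv (𝓡 m) (𝓡 m) (fun x : N => Circle.exp s • x) y).map_add v w)).trans
          ((α (Circle.exp s • y)).vecCons_add ![] _ _)
      rw [hfun, intervalIntegral.integral_add (hint y v) (hint y w), mul_add]
    · intro c v
      have hfun : (fun s : ℝ => α (Circle.exp s • y)
          ![mfderiv (𝓡 m) (𝓡 m) (fun x : N => Circle.exp s • x) y (c • v)]) =
          fun s : ℝ => c * α (Circle.exp s • y)
            ![mfderiv (𝓡 m) (𝓡 m) (fun x : N => Circle.exp s • x) y v] := by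
        funext s
        exact (congrArg (fun z => α (Circle.exp s • y) ![z])
          ((mfderiv (𝓡 m) (𝓡 m) (fun x : N => Circle.exp s • x) y).map_smul c v)).trans
          (((α (Circle.exp s • y)).vecCons_smul ![] c _).trans (smul_eq_mul _ _))
      rw [hfun, intervalIntegral.integral_const_mul, smul_eq_mul]
      ring
  refine ⟨fun y => ContinuousAlternatingMap.ofSubsingleton ℝ (EuclideanSpace ℝ (Fin m)) ℝ
    (0 : Fin 1) (LinearMap.toContinuousLinearMap ((hlin y).mk' _)), fun y v => ?_⟩
  rfl

/-! ### Smoothness of the average -/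

section CamOne

variable {E' : Type*} [NormedAddCommGroup E'] [NormedSpace ℝ E'] [FiniteDimensional ℝ E']

/-- A function into `1`-forms on a finite-dimensional space is `C^∞` on a set as soon as all its
evaluations `q ↦ f q (e)` are. [folklore] -/
theorem contDiffOn_of_apply_vecOne {f : E' → E' [⋀^Fin 1]→L[ℝ] ℝ} {U : Set E'}
    (h : ∀ e : E', ContDiffOn ℝ ∞ (fun q => f q ![e]) U) : ContDiffOn ℝ ∞ f U := by
  set L := ContinuousAlternatingMap.ofSubsingletonLIE (𝕜 := ℝ) (E := E') (F := ℝ) (0 : Fin 1)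
    with hL
  have happly : ∀ (g : E' →L[ℝ] ℝ) (e : E'), L g ![e] = g e := fun g e => rfl
  have hg : ContDiffOn ℝ ∞ (fun q => L.symm (f q)) U := by
    refine contDiffOn_clm_apply.2 fun e => (h e).congr fun q _ => ?_
    show L.symm (f q) e = f q ![e]
    conv_rhs => rw [← L.apply_symm_apply (f q)]
    rw [happly]
  have hf : f = fun q => L (L.symm (f q)) := by
    funext q
    rw [L.apply_symm_apply]
  rw [hf]
  exact L.toContinuousLinearEquiv.contDiff.comp_contDiffOn hg

end CamOne

/-- **The averaging integrand in a chart, cut off, is jointly smooth**: for the extended chart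
`φ` at `x₀`, a model vector `e` and a bump function `ψ` with `tsupport ψ ⊆ φ.target`, the function
`(s, q) ↦ ψ(q) · α_{e^{is} y}(d(e^{is}·)_y (τ_{x₀ → y} e))`, `y = φ⁻¹ q`, is `C^∞` on `ℝ × ℝᵐ`.
[folklore] -/
theorem contDiff_averageIntegrand_chart
    (hθ : ContMDiff ((𝓡 1).prod (𝓡 m)) (𝓡 m) ∞ (fun x : Circle × N => x.1 • x.2))
    {α : MForm (𝓡 m) N ℝ 1} (hα : IsSmoothForm α) (x₀ : N) (e : EuclideanSpace ℝ (Fin m))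
    {ψ : EuclideanSpace ℝ (Fin m) → ℝ} (hψ : ContDiff ℝ ∞ ψ)
    (hψt : tsupport ψ ⊆ (extChartAt (𝓡 m) x₀).target) :
    ContDiff ℝ ∞ fun q : ℝ × EuclideanSpace ℝ (Fin m) =>
      ψ q.2 * α (Circle.exp q.1 • (extChartAt (𝓡 m) x₀).symm q.2)
        ![mfderiv (𝓡 m) (𝓡 m) (fun x : N => Circle.exp q.1 • x) ((extChartAt (𝓡 m) x₀).symm q.2)
          (tangentCoordChange (𝓡 m) x₀ ((extChartAt (𝓡 m) x₀).symm q.2)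
            ((extChartAt (𝓡 m) x₀).symm q.2) e)] := by
  rw [contDiff_iff_contDiffAt]
  rintro ⟨σ, p⟩
  by_cases hp : p ∈ (extChartAt (𝓡 m) x₀).target
  · have hy : (extChartAt (𝓡 m) x₀).symm p ∈ (chartAt (EuclideanSpace ℝ (Fin m)) x₀).source := by
      rw [← extChartAt_source (𝓡 m)]
      exact (extChartAt (𝓡 m) x₀).map_target hp
    have h1 : ContMDiffAt 𝓘(ℝ, EuclideanSpace ℝ (Fin m)) (𝓡 m) ∞ (extChartAt (𝓡 m) x₀).symm p :=
      (contMDiffOn_extChartAt_symm x₀).contMDiffAt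
        ((isOpen_extChartAt_target (I := 𝓡 m) x₀).mem_nhds hp)
    have h2 : ContMDiffAt (𝓘(ℝ, ℝ).prod 𝓘(ℝ, EuclideanSpace ℝ (Fin m))) (𝓘(ℝ, ℝ).prod (𝓡 m)) ∞
        (fun q : ℝ × EuclideanSpace ℝ (Fin m) => (q.1, (extChartAt (𝓡 m) x₀).symm q.2)) (σ, p) :=
      contMDiffAt_fst.prodMk (h1.comp (σ, p) contMDiffAt_snd)
    have h3 := (contMDiffAt_apply_smul_section hθ hα (contMDiffAt_coordField x₀ e hy) σ).comp
      (σ, p) h2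
    have h4 : ContMDiffAt 𝓘(ℝ, ℝ × EuclideanSpace ℝ (Fin m)) 𝓘(ℝ, ℝ) ∞
        (fun q : ℝ × EuclideanSpace ℝ (Fin m) =>
          α (Circle.exp q.1 • (extChartAt (𝓡 m) x₀).symm q.2)
            ![mfderiv (𝓡 m) (𝓡 m) (fun x : N => Circle.exp q.1 • x)
              ((extChartAt (𝓡 m) x₀).symm q.2)
              (tangentCoordChange (𝓡 m) x₀ ((extChartAt (𝓡 m) x₀).symm q.2)
                ((extChartAt (𝓡 m) x₀).symm q.2) e)]) (σ, p) := by
      rw [modelWithCornersSelf_prod, ← chartedSpaceSelf_prod]; exact h3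
    exact (hψ.contDiffAt.comp (σ, p) contDiffAt_snd).mul (contMDiffAt_iff_contDiffAt.1 h4)
  · have hp' : p ∉ tsupport ψ := fun h => hp (hψt h)
    have hzero : ψ =ᶠ[𝓝 p] 0 := notMem_tsupport_iff_eventuallyEq.1 hp'
    have hev : (fun q : ℝ × EuclideanSpace ℝ (Fin m) =>
        ψ q.2 * α (Circle.exp q.1 • (extChartAt (𝓡 m) x₀).symm q.2)
          ![mfderiv (𝓡 m) (𝓡 m) (fun x : N => Circle.exp q.1 • x)
            ((extChartAt (𝓡 m) x₀).symm q.2)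
            (tangentCoordChange (𝓡 m) x₀ ((extChartAt (𝓡 m) x₀).symm q.2)
              ((extChartAt (𝓡 m) x₀).symm q.2) e)]) =ᶠ[𝓝 (σ, p)] fun _ => 0 := by
      have h := (continuousAt_snd (p := (σ, p))).eventually hzero
      filter_upwards [h] with q hq
      simp only [Pi.zero_apply] at hq
      simp [hq]
    exact (contDiffAt_const (c := (0 : ℝ))).congr_of_eventuallyEq hev

/-- **The circle average of a smooth `1`-form is smooth**: a `1`-form `ᾱ` whose values are the
averages `(2π)⁻¹ ∫₀^{2π} α_{e^{is} y}(d(e^{is}·)_y v) ds` is `IsSmoothForm` (in the chart at `x₀`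
its evaluations on the coordinate fields are parametric integrals of jointly smooth integrands;
McDuff–Salamon 2017, §5.5). [cite: McDuffSalamon2017, §5.5 (averaging over a circle action)] -/
theorem isSmoothForm_of_circleAverage
    (hθ : ContMDiff ((𝓡 1).prod (𝓡 m)) (𝓡 m) ∞ (fun x : Circle × N => x.1 • x.2))
    {α : MForm (𝓡 m) N ℝ 1} (hα : IsSmoothForm α) {ᾱ : MForm (𝓡 m) N ℝ 1}
    (hᾱ : ∀ (y : N) (v : TangentSpace (𝓡 m) y), ᾱ y ![v] =
      (2 * π)⁻¹ * ∫ s in (0 : ℝ)..2 * π, α (Circle.exp s • y)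
        ![mfderiv (𝓡 m) (𝓡 m) (fun x : N => Circle.exp s • x) y v]) :
    IsSmoothForm ᾱ := by
  rw [isSmoothForm_iff_smoothAt]
  intro x₀
  obtain ⟨ψ, hψ, hψt, hψ1⟩ := exists_bump_chart (k := m) x₀
  set φ := extChartAt (𝓡 m) x₀ with hφ
  -- an open set around the chart point on which `ψ = 1`, inside the target
  obtain ⟨W, hW1, hWo, hcW⟩ : ∃ W : Set (EuclideanSpace ℝ (Fin m)), (∀ q ∈ W, ψ q = 1) ∧
      IsOpen W ∧ φ x₀ ∈ W := by
    obtain ⟨t, ht, hto, hct⟩ := eventually_nhds_iff.1 hψ1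
    exact ⟨t, ht, hto, hct⟩
  have hWt : W ⊆ φ.target := fun q hq =>
    hψt (subset_tsupport _ (by rw [Function.mem_support, hW1 q hq]; exact one_ne_zero))
  -- each evaluation of the chart representative on `W` is a parametric integral
  have heval : ∀ e : EuclideanSpace ℝ (Fin m), ContDiffOn ℝ ∞ (fun q => ᾱ.inChart x₀ q ![e]) W := by
    intro e
    have hΓ := contDiff_averageIntegrand_chart hθ hα x₀ e hψ hψt
    have hI := Literature.Analysis.FunctionSpaces.contDiff_parametric_intervalIntegral hΓ 0 (2 * π)
    refine (((contDiff_const (c := (2 * π)⁻¹)).mul hI).contDiffOn (s := W)).congr fun q hq => ?_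
    have hq' : q ∈ φ.target := hWt hq
    rw [MForm.inChart_eq_of_mem_target ᾱ hq',
      ContinuousAlternatingMap.compContinuousLinearMap_apply]
    refine (congrArg (ᾱ (φ.symm q)) ?_).trans
      ((hᾱ (φ.symm q) (tangentCoordChange (𝓡 m) x₀ (φ.symm q) (φ.symm q) e)).trans ?_)
    · funext i
      fin_cases i
      rfl
    · congr 1
      refine intervalIntegral.integral_congr fun s _ => ?_
      simp only [hW1 q hq, one_mul]
      rfl
  -- hence the chart representative is smooth on `W`, in particular at the chart point
  have hON : ContDiffOn ℝ ∞ (ᾱ.inChart x₀) W := contDiffOn_of_apply_vecOne heval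
  have hAt : ContDiffAt ℝ ∞ (ᾱ.inChart x₀) (φ x₀) := hON.contDiffAt (hWo.mem_nhds hcW)
  exact hAt.contDiffWithinAt


/-! ### Invariance of the average -/

omit [IsManifold (𝓡 m) ∞ N] in
/-- The maps `x ↦ a • x` of a smooth action are `C^∞`. [folklore] -/
theorem contMDiff_constSMul
    (hθ : ContMDiff ((𝓡 1).prod (𝓡 m)) (𝓡 m) ∞ (fun x : Circle × N => x.1 • x.2)) (a : Circle) :
    ContMDiff (𝓡 m) (𝓡 m) ∞ (fun x : N => a • x) :=
  hθ.comp (contMDiff_const.prodMk contMDiff_id)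

omit [IsManifold (𝓡 m) ∞ N] in
/-- **Group law for the differentials**: `d(e^{is}·)_{e^{it} n} ∘ d(e^{it}·)_n = d(e^{i(s+t)}·)_n`.
[folklore] -/
theorem mfderiv_smul_mfderiv_smul
    (hθ : ContMDiff ((𝓡 1).prod (𝓡 m)) (𝓡 m) ∞ (fun x : Circle × N => x.1 • x.2))
    (s t : ℝ) (n : N) (v : TangentSpace (𝓡 m) n) :
    mfderiv (𝓡 m) (𝓡 m) (fun x : N => Circle.exp s • x) (Circle.exp t • n)
        (mfderiv (𝓡 m) (𝓡 m) (fun x : N => Circle.exp t • x) n v) =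
      mfderiv (𝓡 m) (𝓡 m) (fun x : N => Circle.exp (s + t) • x) n v := by
  have hg : MDifferentiableAt (𝓡 m) (𝓡 m) (fun x : N => Circle.exp s • x) (Circle.exp t • n) :=
    (contMDiff_constSMul hθ _ _).mdifferentiableAt (by norm_num)
  have hf : MDifferentiableAt (𝓡 m) (𝓡 m) (fun x : N => Circle.exp t • x) n :=
    (contMDiff_constSMul hθ _ _).mdifferentiableAt (by norm_num)
  have hcomp := mfderiv_comp n hg hf
  have heq : ((fun x : N => Circle.exp s • x) ∘ fun x : N => Circle.exp t • x) =
      fun x : N => Circle.exp (s + t) • x := by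
    funext x
    simp only [Function.comp_apply, smul_smul, Circle.exp_add]
  rw [heq] at hcomp
  exact (congrArg (fun L : TangentSpace (𝓡 m) n →L[ℝ] TangentSpace (𝓡 m)
    (Circle.exp s • (Circle.exp t • n)) => L v) hcomp).symm

omit [IsManifold (𝓡 m) ∞ N] in
/-- **The circle average is invariant under the action**: `(a • ·)^* ᾱ = ᾱ` for every `a ∈ S¹`
(substitute `s ↦ s + t` in the `2π`-periodic integral, `a = e^{it}`; McDuff–Salamon 2017,
§5.5). [cite: McDuffSalamon2017, §5.5 (averaging over a circle action)] -/
theorem invariant_of_circleAverage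
    (hθ : ContMDiff ((𝓡 1).prod (𝓡 m)) (𝓡 m) ∞ (fun x : Circle × N => x.1 • x.2))
    {α ᾱ : MForm (𝓡 m) N ℝ 1}
    (hᾱ : ∀ (y : N) (v : TangentSpace (𝓡 m) y), ᾱ y ![v] =
      (2 * π)⁻¹ * ∫ s in (0 : ℝ)..2 * π, α (Circle.exp s • y)
        ![mfderiv (𝓡 m) (𝓡 m) (fun x : N => Circle.exp s • x) y v])
    (a : Circle) (n : N) (v : Fin 1 → TangentSpace (𝓡 m) n) :
    ᾱ (a • n) (fun i => mfderiv (𝓡 m) (𝓡 m) (fun x : N => a • x) n (v i)) = ᾱ n v := by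
  obtain ⟨t, rfl⟩ := Circle.exp_surjective a
  have hv : v = ![v 0] := by
    funext i
    fin_cases i
    rfl
  have hw : (fun i => mfderiv (𝓡 m) (𝓡 m) (fun x : N => Circle.exp t • x) n (v i)) =
      ![mfderiv (𝓡 m) (𝓡 m) (fun x : N => Circle.exp t • x) n (v 0)] := by
    funext i
    fin_cases i
    rfl
  -- the integrand on the left is the `t`-translate of the `2π`-periodic integrand on the right
  set g : ℝ → ℝ := fun s => α (Circle.exp s • n)
    ![mfderiv (𝓡 m) (𝓡 m) (fun x : N => Circle.exp s • x) n (v 0)] with hg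
  have hper : Function.Periodic g (2 * π) := fun s => by
    show α (Circle.exp (s + 2 * π) • n)
      ![mfderiv (𝓡 m) (𝓡 m) (fun x : N => Circle.exp (s + 2 * π) • x) n (v 0)] = _
    rw [Circle.periodic_exp s]
  have hshift : ∀ s : ℝ, α (Circle.exp s • (Circle.exp t • n))
      ![mfderiv (𝓡 m) (𝓡 m) (fun x : N => Circle.exp s • x) (Circle.exp t • n)
        (mfderiv (𝓡 m) (𝓡 m) (fun x : N => Circle.exp t • x) n (v 0))] = g (s + t) := by
    intro s
    rw [mfderiv_smul_mfderiv_smul hθ]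
    have hpt : Circle.exp s • (Circle.exp t • n) = Circle.exp (s + t) • n := by
      rw [smul_smul, Circle.exp_add]
    rw [hpt]
  have h1 : ∫ s in (0 : ℝ)..2 * π, g (s + t) = ∫ s in (0 : ℝ)..2 * π, g s := by
    rw [intervalIntegral.integral_comp_add_right g t, zero_add,
      show 2 * π + t = t + 2 * π from add_comm _ _, hper.intervalIntegral_add_eq t 0, zero_add]
  rw [hw, hᾱ]
  conv_rhs => rw [hv, hᾱ]
  congr 1
  rw [← h1]
  exact intervalIntegral.integral_congr fun s _ => hshift s

/-! ### The value on an invariant vector field -/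

omit [IsManifold (𝓡 m) ∞ N] in
/-- **Infinitesimal equivariance of the orbit velocity**: `d(e^{is}·)_n X_n = X_{e^{is} n}` for
the fundamental vector field `X_y = d/dt|₀ e^{it} • y` (both are the velocity of the orbit of
`n` at time `s`). [folklore] -/
theorem mfderiv_smul_orbitVelocity
    (hθ : ContMDiff ((𝓡 1).prod (𝓡 m)) (𝓡 m) ∞ (fun x : Circle × N => x.1 • x.2))
    (s : ℝ) (n : N) :
    mfderiv (𝓡 m) (𝓡 m) (fun x : N => Circle.exp s • x) n
        (mfderiv 𝓘(ℝ, ℝ) (𝓡 m) (fun t : ℝ => Circle.exp t • n) 0 (1 : ℝ)) =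
      mfderiv 𝓘(ℝ, ℝ) (𝓡 m) (fun t : ℝ => Circle.exp t • (Circle.exp s • n)) 0 (1 : ℝ) := by
  -- `e^{is} • (e^{it} • n) = e^{it} • (e^{is} • n)`: the left side is the velocity of this curve
  have hγ : ContMDiff 𝓘(ℝ, ℝ) (𝓡 m) ∞ (fun t : ℝ => Circle.exp t • n) :=
    contMDiff_circleOrbit (θ := fun (a : Circle) (x : N) => a • x) hθ n
  have hf : MDifferentiableAt 𝓘(ℝ, ℝ) (𝓡 m) (fun t : ℝ => Circle.exp t • n) 0 :=
    hγ.mdifferentiableAt (by norm_num)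
  have hg0 : MDifferentiableAt (𝓡 m) (𝓡 m) (fun x : N => Circle.exp s • x)
      ((fun t : ℝ => Circle.exp t • n) 0) :=
    (contMDiff_constSMul hθ _ _).mdifferentiableAt (by norm_num)
  have hcomp := mfderiv_comp 0 hg0 hf
  have heq : ((fun x : N => Circle.exp s • x) ∘ fun t : ℝ => Circle.exp t • n) =
      fun t : ℝ => Circle.exp t • (Circle.exp s • n) := by
    funext t
    simp only [Function.comp_apply, smul_smul, mul_comm (Circle.exp s) (Circle.exp t)]
  rw [heq] at hcomp
  have h0 : Circle.exp 0 • n = n := by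
    rw [Circle.exp_zero, one_smul]
  have key := (congrArg (fun L : TangentSpace 𝓘(ℝ, ℝ) (0 : ℝ) →L[ℝ] TangentSpace (𝓡 m)
    (Circle.exp s • ((fun t : ℝ => Circle.exp t • n) 0)) => L (1 : ℝ)) hcomp)
  simp only [ContinuousLinearMap.comp_apply] at key
  rw [h0] at key
  exact key.symm

omit [IsManifold (𝓡 m) ∞ N] in
/-- **The average of a form with `α(X) ≡ 1` again has `ᾱ(X) ≡ 1`** (`X` the fundamental vector
field; the integrand is constant `1` by infinitesimal equivariance). [folklore] -/
theorem circleAverage_apply_orbitVelocity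
    (hθ : ContMDiff ((𝓡 1).prod (𝓡 m)) (𝓡 m) ∞ (fun x : Circle × N => x.1 • x.2))
    {α ᾱ : MForm (𝓡 m) N ℝ 1}
    (hᾱ : ∀ (y : N) (v : TangentSpace (𝓡 m) y), ᾱ y ![v] =
      (2 * π)⁻¹ * ∫ s in (0 : ℝ)..2 * π, α (Circle.exp s • y)
        ![mfderiv (𝓡 m) (𝓡 m) (fun x : N => Circle.exp s • x) y v])
    (hX : ∀ y : N, α y ![mfderiv 𝓘(ℝ, ℝ) (𝓡 m) (fun t : ℝ => Circle.exp t • y) 0 (1 : ℝ)] = 1)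
    (n : N) :
    ᾱ n ![mfderiv 𝓘(ℝ, ℝ) (𝓡 m) (fun t : ℝ => Circle.exp t • n) 0 (1 : ℝ)] = 1 := by
  rw [hᾱ]
  have hfun : (fun s : ℝ => α (Circle.exp s • n)
      ![mfderiv (𝓡 m) (𝓡 m) (fun x : N => Circle.exp s • x) n
        (mfderiv 𝓘(ℝ, ℝ) (𝓡 m) (fun t : ℝ => Circle.exp t • n) 0 (1 : ℝ))]) = fun _ => 1 := by
    funext s
    rw [mfderiv_smul_orbitVelocity hθ s n]
    exact hX _
  rw [hfun, intervalIntegral.integral_const, smul_eq_mul, mul_one, sub_zero,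
    inv_mul_cancel₀ (by positivity)]

/-- **The circle average of a smooth `1`-form**, assembled: a smooth invariant `1`-form with the
averaged values (McDuff–Salamon 2017, §5.5).
[cite: McDuffSalamon2017, §5.5 (averaging over a circle action)] -/
theorem exists_circleAverage_oneForm
    (hθ : ContMDiff ((𝓡 1).prod (𝓡 m)) (𝓡 m) ∞ (fun x : Circle × N => x.1 • x.2))
    {α : MForm (𝓡 m) N ℝ 1} (hα : IsSmoothForm α) :
    ∃ ᾱ : MForm (𝓡 m) N ℝ 1, IsSmoothForm ᾱ ∧
      (∀ (a : Circle) (n : N) (v : Fin 1 → TangentSpace (𝓡 m) n),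
        ᾱ (a • n) (fun i => mfderiv (𝓡 m) (𝓡 m) (fun x : N => a • x) n (v i)) = ᾱ n v) ∧
      ∀ (y : N) (v : TangentSpace (𝓡 m) y), ᾱ y ![v] =
        (2 * π)⁻¹ * ∫ s in (0 : ℝ)..2 * π, α (Circle.exp s • y)
          ![mfderiv (𝓡 m) (𝓡 m) (fun x : N => Circle.exp s • x) y v] := by
  obtain ⟨ᾱ, hᾱ⟩ := exists_oneForm_circleAverage hθ hα
  exact ⟨ᾱ, isSmoothForm_of_circleAverage hθ hα hᾱ, invariant_of_circleAverage hθ hᾱ, hᾱ⟩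

end Literature.Geometry.Manifold

end
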